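import Summits.CriticalPhenomena.PercolationContinuityZ3.Theorems.PercNearOneGluingNoHeavyLowerTailAPLSeriesClusters
import Summits.CriticalPhenomena.PercolationContinuityZ3.Theorems.PercNearOneGluingNoHeavyLowerTailAPLGluedCells
import Summits.CriticalPhenomena.PercolationContinuityZ3.Theorems.PercNearOneGluingNoHeavyLowerTailRefinedRowR2FourFunctions
import HarnessLib

/-!
# `NoHeavyLowerTail` (stmt-CriticalPhenomena-4575) — SERIES GLUING AT A CUT VERTEX, II: the exact composition law and
# THE SERIES REDUCTION THEOREM for `E = κ²/(pπ·m)` (`E ≤ C`, `C ≥ 1`, is preserved under gluing `G ∖ o` at a port-separating cut vertex)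

Support file (prover prim-ineq-gen-8 gen 58; `--supports stmt-CriticalPhenomena-4575`; memo
run/shared/lean/prim/prim-ineq-gen-8/FINDING-gen58-SERIES-LEAN.md §1; pencil version memo gen 57 FINDING-gen57-EROUTE.md §0(8)).
No definitions, no named facts, no sorries.

SETTING.  Weights `p : Sym2 V → ℝ` in `[0,1]`, DISJOINT edge sets `D₁, D₂ : Finset (Sym2 V)` glued as in `…APLSeriesClusters.lean`: every
vertex meeting both is the apex `o` or the cut vertex `c`; the port `u` meets `D₂` only if `u = c`, the port `v` meets `D₁` only if
`v = c` (degenerate ports allowed); `u, v ≠ o`, `u ≠ v`.  For an apex `o` and ports `(a, b)` on an edge set `D` write (finite weighted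
probabilities `DecisionTree.PrW D p` of cluster events, `Gladkov.cl`)
`p(a) = P(a ∈ cl o)`, `τ(a,b) = P(a ∈ cl o ∧ b ∈ cl o)`, `κ = τ − p(a)p(b) ≥ 0` (Harris), `m(a,b) = P(a ∉ cl o ∧ b ∈ cl a)` (ports joined,
apex not joined to them), and the lineage's ratio `E = κ²/(p(a)p(b)·m)` (Conjecture (★★₂): `E ≤ 2`; Conjecture E: `E ≤ C* ≈ 1.18`;
weak Conjecture E: `E ≤ C` for some `C`; (★★₃) = kernel `threePoint_all` gives `E ≤ 3 + κ/m`).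
Piece 1 is the instance `(o; u, c)` on `D₁` (`p₁, π₁ = p(c), τ₁, m₁`), piece 2 the instance `(o; v, c)` on `D₂`, the composite the
instance `(o; u, v)` on `D₁ ∪ D₂`.
* `series_ind_p/pi/tau/m` — pointwise indicator identities (from the join formulas of `…APLSeriesClusters.lean`).
* **`series_p`**: `p = p₁ + m₁·π₂`;  **`series_pi`**: `π = p₂ + m₂·π₁`;  **`series_tau`**: `τ = p₁·p₂ + m₁·τ₂ + m₂·τ₁`;
  **`series_m`**: `m = m₁·m₂` — THE EXACT SERIES COMPOSITION LAW (memo gen 57 (SER) in the two-piece form of gen 58: the apex edge at the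
  cut vertex, if any, is simply an edge of one of the pieces).  Consequently `κ = m₁κ₂ + m₂κ₁ − m₁m₂π₁π₂`
  ("excess ratios add across a cut vertex": `κ/m = (κ₁/m₁ − π₁) + (κ₂/m₂ − π₂) + (π₁ + π₂ − π₁π₂)`).
* `PrW_harris_cl` — Harris for the two apex connections at the `PrW` level (four functions theorem `RefinedRowR2.PrW_fourEvents`);
  `PrW_cl_le_one`.
* `series_real` — the real-variable core: from the law, `κᵢ² ≤ C pᵢπᵢmᵢ`, `κᵢ ≥ 0`, `C ≥ 1`: `κ² ≤ C·pπ·m` (if `κ ≥ 0` then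
  `κ ≤ m₁κ₂ + m₂κ₁` and two AM–GM steps — `series_core` of `…APLSeriesCore.lean` at `q = 1`; if `κ < 0` then `|κ| ≤ m₁m₂π₁π₂`;
  NO Harris inequality for the composite is needed).
* **`series_reduction`** — THE THEOREM: `E(D₁; o; u, c) ≤ C` and `E(D₂; o; v, c) ≤ C` imply `E(D₁ ∪ D₂; o; u, v) ≤ C`, all in the
  division-free form `κ² ≤ C·p·π·m`.  Hence `sup E` over all finite weighted graphs = `sup E` over PORT-BICONNECTED configurations (no
  vertex of `G ∖ o` separates the ports), and `E ≤ 1` on everything glued from `E ≤ 1` pieces — beads hung at ports, apex-over-path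
  graphs (`…APLFanTheorem.lean`).
[this work; the law was verified beforehand in exact rational arithmetic on random glued graphs incl. degenerate ports,
HOME/code-g58/check_series2.py]
-/

namespace Summit.CriticalPhenomena.PercolationContinuityZ3.Theorems

namespace APL

open Literature.Probability.Percolation Literature.Probability.Percolation.Gladkov Literature.Probability.Percolation.DecisionTree
open scoped Classical

section Ind

/-- `1[x ∈ X] = 1[y ∈ Y]·1[z ∈ Z]` when `x ∈ X ↔ y ∈ Y ∧ z ∈ Z`. [folklore] -/
theorem ind_eq_mul_of_iff {α β γ : Type*} {X : Set α} {Y : Set β} {Z : Set γ} {x : α} {y : β} {z : γ}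
    (h : x ∈ X ↔ (y ∈ Y ∧ z ∈ Z)) : ind X x = ind Y y * ind Z z := by
  by_cases hy : y ∈ Y <;> by_cases hz : z ∈ Z <;> simp [ind, h, hy, hz]

end Ind

variable {V : Type*} [Fintype V] [DecidableEq V]

/-! ### Pointwise indicator identities -/

/-- Pointwise form of `p = p₁ + m₁π₂`. [this work] -/
theorem series_ind_p (S₁ S₂ : Finset (Sym2 V)) (o c u : V)
    (hsep : ∀ x : V, (∃ e ∈ S₁, x ∈ e) → (∃ e ∈ S₂, x ∈ e) → (x = o ∨ x = c))
    (hu : ∀ e ∈ S₂, u ∈ e → u = c) (huo : u ≠ o) :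
    ind {K : Finset (Sym2 V) | u ∈ cl K o} (S₁ ∪ S₂)
      = ind {K : Finset (Sym2 V) | u ∈ cl K o} S₁
        + ind {K : Finset (Sym2 V) | u ∉ cl K o ∧ c ∈ cl K u} S₁ * ind {K : Finset (Sym2 V) | c ∈ cl K o} S₂ := by
  have hou := series_ou_iff S₁ S₂ o c u hsep hu huo
  rcases cl_cell_cases S₁ o u c with ⟨h1, h2, h3⟩ | ⟨h1, h2, h3⟩ | ⟨h1, h2, h3⟩ | ⟨h1, h2, h3⟩ | ⟨h1, h2, h3⟩ <;>
  by_cases k : c ∈ cl S₂ o <;>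
  simp [ind, Set.mem_setOf_eq, hou, h1, h2, h3, k]

/-- Pointwise form of `π = p₂ + m₂π₁`. [this work] -/
theorem series_ind_pi (S₁ S₂ : Finset (Sym2 V)) (o c v : V)
    (hsep : ∀ x : V, (∃ e ∈ S₁, x ∈ e) → (∃ e ∈ S₂, x ∈ e) → (x = o ∨ x = c))
    (hv : ∀ e ∈ S₁, v ∈ e → v = c) (hvo : v ≠ o) :
    ind {K : Finset (Sym2 V) | v ∈ cl K o} (S₁ ∪ S₂)
      = ind {K : Finset (Sym2 V) | v ∈ cl K o} S₂
        + ind {K : Finset (Sym2 V) | v ∉ cl K o ∧ c ∈ cl K v} S₂ * ind {K : Finset (Sym2 V) | c ∈ cl K o} S₁ := by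
  have hov := series_ov_iff S₁ S₂ o c v hsep hv hvo
  rcases cl_cell_cases S₂ o v c with ⟨h1, h2, h3⟩ | ⟨h1, h2, h3⟩ | ⟨h1, h2, h3⟩ | ⟨h1, h2, h3⟩ | ⟨h1, h2, h3⟩ <;>
  by_cases k : c ∈ cl S₁ o <;>
  simp [ind, Set.mem_setOf_eq, hov, h1, h2, h3, k]

/-- Pointwise form of `τ = p₁p₂ + m₁τ₂ + m₂τ₁`. [this work] -/
theorem series_ind_tau (S₁ S₂ : Finset (Sym2 V)) (o c u v : V)
    (hsep : ∀ x : V, (∃ e ∈ S₁, x ∈ e) → (∃ e ∈ S₂, x ∈ e) → (x = o ∨ x = c))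
    (hu : ∀ e ∈ S₂, u ∈ e → u = c) (hv : ∀ e ∈ S₁, v ∈ e → v = c) (huo : u ≠ o) (hvo : v ≠ o) :
    ind {K : Finset (Sym2 V) | u ∈ cl K o ∧ v ∈ cl K o} (S₁ ∪ S₂)
      = ind {K : Finset (Sym2 V) | u ∈ cl K o} S₁ * ind {K : Finset (Sym2 V) | v ∈ cl K o} S₂
        + ind {K : Finset (Sym2 V) | u ∉ cl K o ∧ c ∈ cl K u} S₁ * ind {K : Finset (Sym2 V) | v ∈ cl K o ∧ c ∈ cl K o} S₂
        + ind {K : Finset (Sym2 V) | v ∉ cl K o ∧ c ∈ cl K v} S₂ * ind {K : Finset (Sym2 V) | u ∈ cl K o ∧ c ∈ cl K o} S₁ := by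
  have hou := series_ou_iff S₁ S₂ o c u hsep hu huo
  have hov := series_ov_iff S₁ S₂ o c v hsep hv hvo
  rcases cl_cell_cases S₁ o u c with ⟨h1, h2, h3⟩ | ⟨h1, h2, h3⟩ | ⟨h1, h2, h3⟩ | ⟨h1, h2, h3⟩ | ⟨h1, h2, h3⟩ <;>
  rcases cl_cell_cases S₂ o v c with ⟨k1, k2, k3⟩ | ⟨k1, k2, k3⟩ | ⟨k1, k2, k3⟩ | ⟨k1, k2, k3⟩ | ⟨k1, k2, k3⟩ <;>
  simp [ind, Set.mem_setOf_eq, hou, hov, h1, h2, h3, k1, k2, k3]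

/-- Pointwise form of `m = m₁m₂`. [this work] -/
theorem series_ind_m (S₁ S₂ : Finset (Sym2 V)) (o c u v : V)
    (hsep : ∀ x : V, (∃ e ∈ S₁, x ∈ e) → (∃ e ∈ S₂, x ∈ e) → (x = o ∨ x = c))
    (hu : ∀ e ∈ S₂, u ∈ e → u = c) (hv : ∀ e ∈ S₁, v ∈ e → v = c) (huo : u ≠ o) (huv : u ≠ v) :
    ind {K : Finset (Sym2 V) | u ∉ cl K o ∧ v ∈ cl K u} (S₁ ∪ S₂)
      = ind {K : Finset (Sym2 V) | u ∉ cl K o ∧ c ∈ cl K u} S₁ * ind {K : Finset (Sym2 V) | v ∉ cl K o ∧ c ∈ cl K v} S₂ :=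
  ind_eq_mul_of_iff (series_m_iff S₁ S₂ o c u v hsep hu hv huo huv)

/-! ### The composition law for `PrW` -/

omit [Fintype V] [DecidableEq V] in
/-- The gluing hypothesis restricts to sub-configurations. [folklore] -/
theorem series_hsep_mono {D₁ D₂ S₁ S₂ : Finset (Sym2 V)} {o c : V}
    (hsep : ∀ x : V, (∃ e ∈ D₁, x ∈ e) → (∃ e ∈ D₂, x ∈ e) → (x = o ∨ x = c)) (hS₁ : S₁ ⊆ D₁) (hS₂ : S₂ ⊆ D₂) :
    ∀ x : V, (∃ e ∈ S₁, x ∈ e) → (∃ e ∈ S₂, x ∈ e) → (x = o ∨ x = c) :=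
  fun x h1 h2 => hsep x (h1.imp fun _ he => ⟨hS₁ he.1, he.2⟩) (h2.imp fun _ he => ⟨hS₂ he.1, he.2⟩)

section Law

variable (p : Sym2 V → ℝ) (D₁ D₂ : Finset (Sym2 V)) (hdisj : Disjoint D₁ D₂) (o c u v : V)
  (hsep : ∀ x : V, (∃ e ∈ D₁, x ∈ e) → (∃ e ∈ D₂, x ∈ e) → (x = o ∨ x = c))
  (hu : ∀ e ∈ D₂, u ∈ e → u = c) (hv : ∀ e ∈ D₁, v ∈ e → v = c) (huo : u ≠ o) (hvo : v ≠ o) (huv : u ≠ v)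

include hdisj hsep

include hu huo in
/-- **Series law for `p`**: `P(u ∈ cl o) = p₁ + m₁·π₂`. [this work] -/
theorem series_p :
    PrW (D₁ ∪ D₂) p {K : Finset (Sym2 V) | u ∈ cl K o}
      = PrW D₁ p {K : Finset (Sym2 V) | u ∈ cl K o}
        + PrW D₁ p {K : Finset (Sym2 V) | u ∉ cl K o ∧ c ∈ cl K u} * PrW D₂ p {K : Finset (Sym2 V) | c ∈ cl K o} := by
  have h1 : PrW D₁ p {K : Finset (Sym2 V) | u ∈ cl K o} = PrW D₁ p {K : Finset (Sym2 V) | u ∈ cl K o} * PrW D₂ p Set.univ := by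
    rw [PrW_univ, mul_one]
  rw [h1, PrW_glue_sum p hdisj]
  simp only [PrW_eq_sum_ind, Finset.sum_mul_sum, ← Finset.sum_add_distrib]
  refine Finset.sum_congr rfl fun S₁ hS₁ => Finset.sum_congr rfl fun S₂ hS₂ => ?_
  rw [Finset.mem_powerset] at hS₁ hS₂
  rw [series_ind_p S₁ S₂ o c u (series_hsep_mono hsep hS₁ hS₂) (fun e he => hu e (hS₂ he)) huo,
    ind_of_mem (Set.mem_univ _)]
  ring

include hv hvo in
/-- **Series law for `π`**: `P(v ∈ cl o) = p₂ + m₂·π₁`. [this work] -/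
theorem series_pi :
    PrW (D₁ ∪ D₂) p {K : Finset (Sym2 V) | v ∈ cl K o}
      = PrW D₂ p {K : Finset (Sym2 V) | v ∈ cl K o}
        + PrW D₂ p {K : Finset (Sym2 V) | v ∉ cl K o ∧ c ∈ cl K v} * PrW D₁ p {K : Finset (Sym2 V) | c ∈ cl K o} := by
  have h1 : PrW D₂ p {K : Finset (Sym2 V) | v ∈ cl K o} = PrW D₁ p Set.univ * PrW D₂ p {K : Finset (Sym2 V) | v ∈ cl K o} := by
    rw [PrW_univ, one_mul]
  have h2 : PrW D₂ p {K : Finset (Sym2 V) | v ∉ cl K o ∧ c ∈ cl K v} * PrW D₁ p {K : Finset (Sym2 V) | c ∈ cl K o}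
      = PrW D₁ p {K : Finset (Sym2 V) | c ∈ cl K o} * PrW D₂ p {K : Finset (Sym2 V) | v ∉ cl K o ∧ c ∈ cl K v} := mul_comm _ _
  rw [h1, h2, PrW_glue_sum p hdisj]
  simp only [PrW_eq_sum_ind, Finset.sum_mul_sum, ← Finset.sum_add_distrib]
  refine Finset.sum_congr rfl fun S₁ hS₁ => Finset.sum_congr rfl fun S₂ hS₂ => ?_
  rw [Finset.mem_powerset] at hS₁ hS₂
  rw [series_ind_pi S₁ S₂ o c v (series_hsep_mono hsep hS₁ hS₂) (fun e he => hv e (hS₁ he)) hvo,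
    ind_of_mem (Set.mem_univ _)]
  ring

include hu hv huo hvo in
/-- **Series law for `τ`**: `P(u ∈ cl o ∧ v ∈ cl o) = p₁·p₂ + m₁·τ₂ + m₂·τ₁`. [this work] -/
theorem series_tau :
    PrW (D₁ ∪ D₂) p {K : Finset (Sym2 V) | u ∈ cl K o ∧ v ∈ cl K o}
      = PrW D₁ p {K : Finset (Sym2 V) | u ∈ cl K o} * PrW D₂ p {K : Finset (Sym2 V) | v ∈ cl K o}
        + PrW D₁ p {K : Finset (Sym2 V) | u ∉ cl K o ∧ c ∈ cl K u} * PrW D₂ p {K : Finset (Sym2 V) | v ∈ cl K o ∧ c ∈ cl K o}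
        + PrW D₂ p {K : Finset (Sym2 V) | v ∉ cl K o ∧ c ∈ cl K v} * PrW D₁ p {K : Finset (Sym2 V) | u ∈ cl K o ∧ c ∈ cl K o} := by
  have h2 : PrW D₂ p {K : Finset (Sym2 V) | v ∉ cl K o ∧ c ∈ cl K v} * PrW D₁ p {K : Finset (Sym2 V) | u ∈ cl K o ∧ c ∈ cl K o}
      = PrW D₁ p {K : Finset (Sym2 V) | u ∈ cl K o ∧ c ∈ cl K o} * PrW D₂ p {K : Finset (Sym2 V) | v ∉ cl K o ∧ c ∈ cl K v} :=
    mul_comm _ _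
  rw [h2, PrW_glue_sum p hdisj]
  simp only [PrW_eq_sum_ind, Finset.sum_mul_sum, ← Finset.sum_add_distrib]
  refine Finset.sum_congr rfl fun S₁ hS₁ => Finset.sum_congr rfl fun S₂ hS₂ => ?_
  rw [Finset.mem_powerset] at hS₁ hS₂
  rw [series_ind_tau S₁ S₂ o c u v (series_hsep_mono hsep hS₁ hS₂) (fun e he => hu e (hS₂ he))
    (fun e he => hv e (hS₁ he)) huo hvo]
  ring

include hu hv huo huv in
/-- **Series law for `m`**: `P(u ∉ cl o ∧ v ∈ cl u) = m₁·m₂`. [this work] -/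
theorem series_m :
    PrW (D₁ ∪ D₂) p {K : Finset (Sym2 V) | u ∉ cl K o ∧ v ∈ cl K u}
      = PrW D₁ p {K : Finset (Sym2 V) | u ∉ cl K o ∧ c ∈ cl K u} * PrW D₂ p {K : Finset (Sym2 V) | v ∉ cl K o ∧ c ∈ cl K v} := by
  rw [PrW_glue_sum p hdisj]
  simp only [PrW_eq_sum_ind, Finset.sum_mul_sum]
  refine Finset.sum_congr rfl fun S₁ hS₁ => Finset.sum_congr rfl fun S₂ hS₂ => ?_
  rw [Finset.mem_powerset] at hS₁ hS₂
  rw [series_ind_m S₁ S₂ o c u v (series_hsep_mono hsep hS₁ hS₂) (fun e he => hu e (hS₂ he))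
    (fun e he => hv e (hS₁ he)) huo huv]
  ring

end Law

/-! ### Real-variable core -/

/-- `4x² ≤ s²`, `s ≥ 0` ⟹ `2x ≤ s`. [folklore] -/
private theorem two_mul_le_of_sq' {x s : ℝ} (hs : 0 ≤ s) (h : 4 * x ^ 2 ≤ s ^ 2) : 2 * x ≤ s := by
  nlinarith [sq_nonneg (s - 2 * x), sq_nonneg (s + 2 * x), hs]

/-- **Real-variable core of the series reduction** (two-piece form, no `q`): if `κᵢ = τᵢ − pᵢπᵢ ≥ 0`, `κᵢ² ≤ C pᵢπᵢmᵢ` (`i = 1,2`),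
`C ≥ 1`, `pᵢ, mᵢ ≥ 0`, `0 ≤ πᵢ ≤ 1`, then the composite `κ = p₁p₂ + m₁τ₂ + m₂τ₁ − (p₁ + m₁π₂)(p₂ + m₂π₁)` satisfies
`κ² ≤ C (p₁ + m₁π₂)(p₂ + m₂π₁)(m₁m₂)`. [this work] -/
theorem series_real (C p₁ π₁ τ₁ m₁ p₂ π₂ τ₂ m₂ : ℝ) (hC : 1 ≤ C)
    (hp₁ : 0 ≤ p₁) (hπ₁ : 0 ≤ π₁) (hπ₁1 : π₁ ≤ 1) (hm₁ : 0 ≤ m₁)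
    (hp₂ : 0 ≤ p₂) (hπ₂ : 0 ≤ π₂) (hπ₂1 : π₂ ≤ 1) (hm₂ : 0 ≤ m₂)
    (hk₁ : p₁ * π₁ ≤ τ₁) (hk₂ : p₂ * π₂ ≤ τ₂)
    (hE₁ : (τ₁ - p₁ * π₁) ^ 2 ≤ C * p₁ * π₁ * m₁) (hE₂ : (τ₂ - p₂ * π₂) ^ 2 ≤ C * p₂ * π₂ * m₂) :
    (p₁ * p₂ + m₁ * τ₂ + m₂ * τ₁ - (p₁ + m₁ * π₂) * (p₂ + m₂ * π₁)) ^ 2 ≤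
      C * (p₁ + m₁ * π₂) * (p₂ + m₂ * π₁) * (m₁ * m₂) := by
  have hC0 : 0 ≤ C := le_trans zero_le_one hC
  set k₁ := τ₁ - p₁ * π₁ with hk₁def
  set k₂ := τ₂ - p₂ * π₂ with hk₂def
  have hk₁0 : 0 ≤ k₁ := by rw [hk₁def]; linarith
  have hk₂0 : 0 ≤ k₂ := by rw [hk₂def]; linarith
  -- the composite covariance
  have hκ : p₁ * p₂ + m₁ * τ₂ + m₂ * τ₁ - (p₁ + m₁ * π₂) * (p₂ + m₂ * π₁) =
      m₁ * k₂ + m₂ * k₁ - m₁ * m₂ * π₁ * π₂ := by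
    rw [hk₁def, hk₂def]; ring
  rw [hκ]
  have hX0 : 0 ≤ m₂ * k₁ := mul_nonneg hm₂ hk₁0
  have hY0 : 0 ≤ m₁ * k₂ := mul_nonneg hm₁ hk₂0
  have hmm : 0 ≤ m₁ * m₂ := mul_nonneg hm₁ hm₂
  have hππ : 0 ≤ π₁ * π₂ := mul_nonneg hπ₁ hπ₂
  have hππ1 : π₁ * π₂ ≤ 1 := by nlinarith
  have hN0 : 0 ≤ m₁ * m₂ * π₁ * π₂ := by nlinarith
  -- the right-hand side, expanded
  have eR : C * (p₁ + m₁ * π₂) * (p₂ + m₂ * π₁) * (m₁ * m₂) =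
      C * (m₁ * m₂) * (m₂ * p₁ * π₁) + C * (m₁ * m₂) * (m₁ * p₂ * π₂)
        + (C * (m₁ * m₂) * (p₁ * p₂) + C * (m₁ * m₂) * (m₁ * m₂ * π₁ * π₂)) := by ring
  -- squares of the two pieces
  have sX : (m₂ * k₁) ^ 2 ≤ C * (m₁ * m₂) * (m₂ * p₁ * π₁) := by
    have := mul_le_mul_of_nonneg_left hE₁ (sq_nonneg m₂)
    nlinarith [this]
  have sY : (m₁ * k₂) ^ 2 ≤ C * (m₁ * m₂) * (m₁ * p₂ * π₂) := by
    have := mul_le_mul_of_nonneg_left hE₂ (sq_nonneg m₁)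
    nlinarith [this]
  -- the cross term by AM–GM
  have cross : 2 * ((m₂ * k₁) * (m₁ * k₂)) ≤ C * (m₁ * m₂) * (p₁ * p₂) + C * (m₁ * m₂) * (m₁ * m₂ * π₁ * π₂) := by
    apply two_mul_le_of_sq'
    · nlinarith [mul_nonneg (mul_nonneg hC0 hmm) (mul_nonneg hp₁ hp₂), mul_nonneg (mul_nonneg hC0 hmm) hN0]
    · have h1 : (m₂ * k₁) ^ 2 * (m₁ * k₂) ^ 2 ≤ (C * (m₁ * m₂) * (m₂ * p₁ * π₁)) * (C * (m₁ * m₂) * (m₁ * p₂ * π₂)) :=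
        mul_le_mul sX sY (sq_nonneg _) (le_trans (sq_nonneg _) sX)
      have h2 : 4 * (C * (m₁ * m₂) * (p₁ * p₂)) * (C * (m₁ * m₂) * (m₁ * m₂ * π₁ * π₂)) ≤
          (C * (m₁ * m₂) * (p₁ * p₂) + C * (m₁ * m₂) * (m₁ * m₂ * π₁ * π₂)) ^ 2 := by
        nlinarith [sq_nonneg (C * (m₁ * m₂) * (p₁ * p₂) - C * (m₁ * m₂) * (m₁ * m₂ * π₁ * π₂))]
      have h3 : 4 * ((m₂ * k₁) * (m₁ * k₂)) ^ 2 = 4 * ((m₂ * k₁) ^ 2 * (m₁ * k₂) ^ 2) := by ring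
      have h4 : (C * (m₁ * m₂) * (m₂ * p₁ * π₁)) * (C * (m₁ * m₂) * (m₁ * p₂ * π₂)) =
          (C * (m₁ * m₂) * (p₁ * p₂)) * (C * (m₁ * m₂) * (m₁ * m₂ * π₁ * π₂)) := by ring
      rw [h3]
      rw [h4] at h1
      nlinarith [h1, h2]
  rcases le_or_gt 0 (m₁ * k₂ + m₂ * k₁ - m₁ * m₂ * π₁ * π₂) with hpos | hneg
  · -- `κ ≥ 0`: `κ ≤ m₁k₂ + m₂k₁`
    have hle : m₁ * k₂ + m₂ * k₁ - m₁ * m₂ * π₁ * π₂ ≤ m₂ * k₁ + m₁ * k₂ := by linarith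
    have hsq : (m₁ * k₂ + m₂ * k₁ - m₁ * m₂ * π₁ * π₂) ^ 2 ≤ (m₂ * k₁ + m₁ * k₂) ^ 2 :=
      pow_le_pow_left₀ hpos hle 2
    have eL : (m₂ * k₁ + m₁ * k₂) ^ 2 = (m₂ * k₁) ^ 2 + (m₁ * k₂) ^ 2 + 2 * ((m₂ * k₁) * (m₁ * k₂)) := by ring
    rw [eR]
    linarith [hsq, eL, sX, sY, cross]
  · -- `κ < 0`: `|κ| ≤ m₁m₂π₁π₂`
    have hge : -(m₁ * m₂ * π₁ * π₂) ≤ m₁ * k₂ + m₂ * k₁ - m₁ * m₂ * π₁ * π₂ := by linarith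
    have hsq : (m₁ * k₂ + m₂ * k₁ - m₁ * m₂ * π₁ * π₂) ^ 2 ≤ (m₁ * m₂ * π₁ * π₂) ^ 2 := by
      have hprod : (m₁ * k₂ + m₂ * k₁ - m₁ * m₂ * π₁ * π₂ - m₁ * m₂ * π₁ * π₂) *
          (m₁ * k₂ + m₂ * k₁ - m₁ * m₂ * π₁ * π₂ + m₁ * m₂ * π₁ * π₂) ≤ 0 :=
        mul_nonpos_of_nonpos_of_nonneg (by linarith) (by linarith)
      have e : (m₁ * k₂ + m₂ * k₁ - m₁ * m₂ * π₁ * π₂) ^ 2 =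
          (m₁ * k₂ + m₂ * k₁ - m₁ * m₂ * π₁ * π₂ - m₁ * m₂ * π₁ * π₂) *
            (m₁ * k₂ + m₂ * k₁ - m₁ * m₂ * π₁ * π₂ + m₁ * m₂ * π₁ * π₂) + (m₁ * m₂ * π₁ * π₂) ^ 2 := by ring
      rw [e]; linarith
    have h5 : (m₁ * m₂ * π₁ * π₂) ^ 2 ≤ C * (m₁ * m₂) * (m₁ * m₂ * π₁ * π₂) := by
      have e1 : (m₁ * m₂ * π₁ * π₂) ^ 2 = (π₁ * π₂) * ((m₁ * m₂) * (m₁ * m₂ * π₁ * π₂)) := by ring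
      have e2 : C * (m₁ * m₂) * (m₁ * m₂ * π₁ * π₂) = C * ((m₁ * m₂) * (m₁ * m₂ * π₁ * π₂)) := by ring
      rw [e1, e2]
      exact mul_le_mul_of_nonneg_right (hππ1.trans hC) (mul_nonneg hmm hN0)
    rw [eR]
    linarith [hsq, h5, mul_nonneg (mul_nonneg hC0 hmm) (mul_nonneg (mul_nonneg hm₂ hp₁) hπ₁),
      mul_nonneg (mul_nonneg hC0 hmm) (mul_nonneg (mul_nonneg hm₁ hp₂) hπ₂),
      mul_nonneg (mul_nonneg hC0 hmm) (mul_nonneg hp₁ hp₂)]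

/-! ### Harris and bounds at the `PrW` level -/

/-- **Harris for the two apex connections** (`PrW` level): `P(a ∈ cl o)·P(b ∈ cl o) ≤ P(a ∈ cl o ∧ b ∈ cl o)`, from the four functions
theorem on the weighted cube. [folklore] -/
theorem PrW_harris_cl (D : Finset (Sym2 V)) {p : Sym2 V → ℝ} (hp0 : ∀ e, 0 ≤ p e) (hp1 : ∀ e, p e ≤ 1) (o a b : V) :
    PrW D p {K : Finset (Sym2 V) | a ∈ cl K o} * PrW D p {K : Finset (Sym2 V) | b ∈ cl K o} ≤
      PrW D p {K : Finset (Sym2 V) | a ∈ cl K o ∧ b ∈ cl K o} := by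
  have h := RefinedRowR2.PrW_fourEvents D hp0 hp1 {K : Finset (Sym2 V) | a ∈ cl K o} {K : Finset (Sym2 V) | b ∈ cl K o}
    Set.univ {K : Finset (Sym2 V) | a ∈ cl K o ∧ b ∈ cl K o} (fun S _ T _ hS hT => ⟨Set.mem_univ _,
      ⟨ThreePointLB.cl_mono Finset.subset_union_left o hS, ThreePointLB.cl_mono Finset.subset_union_right o hT⟩⟩)
  rwa [PrW_univ, one_mul] at h

omit [Fintype V] in
/-- `PrW D p X ≤ 1` for weights in `[0,1]`. [folklore] -/
theorem PrW_cl_le_one (D : Finset (Sym2 V)) {p : Sym2 V → ℝ} (hp0 : ∀ e, 0 ≤ p e) (hp1 : ∀ e, p e ≤ 1)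
    (X : Set (Finset (Sym2 V))) : PrW D p X ≤ 1 := by
  have h : PrW D p X ≤ PrW D p Set.univ := PrW_mono D hp0 hp1 fun S _ _ => Set.mem_univ S
  rwa [PrW_univ] at h

/-! ### The theorem -/

/-- **SERIES REDUCTION THEOREM** (memo gen 57 §0(8), kernel form gen 58).  Let `D₁, D₂` be disjoint edge sets such that every vertex
meeting both is the apex `o` or the cut vertex `c`, the port `u` meets `D₂` only if `u = c`, the port `v` meets `D₁` only if `v = c`,
`u ≠ v`, `u, v ≠ o`, weights `p ∈ [0,1]`, and `C ≥ 1`.  If the pieces satisfy `E ≤ C`, i.e.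
`(τ₁ − p₁π₁)² ≤ C·p₁π₁·m₁` for `(o; u, c)` on `D₁` and `(τ₂ − p₂π₂)² ≤ C·p₂π₂·m₂` for `(o; v, c)` on `D₂`
(`p = P(o↔port)`, `π = P(o↔c)`, `τ = P(both)`, `m = P(port↔c, o↮port)`), then the glued configuration satisfies `E ≤ C`:
`(P(o↔u,o↔v) − P(o↔u)P(o↔v))² ≤ C·P(o↔u)·P(o↔v)·P(u↔v, o↮u)` on `D₁ ∪ D₂`. [this work] -/
theorem series_reduction (p : Sym2 V → ℝ) (hp0 : ∀ e, 0 ≤ p e) (hp1 : ∀ e, p e ≤ 1)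
    (D₁ D₂ : Finset (Sym2 V)) (hdisj : Disjoint D₁ D₂) (o c u v : V)
    (hsep : ∀ x : V, (∃ e ∈ D₁, x ∈ e) → (∃ e ∈ D₂, x ∈ e) → (x = o ∨ x = c))
    (hu : ∀ e ∈ D₂, u ∈ e → u = c) (hv : ∀ e ∈ D₁, v ∈ e → v = c) (huo : u ≠ o) (hvo : v ≠ o) (huv : u ≠ v)
    (C : ℝ) (hC : 1 ≤ C)
    (hE₁ : (PrW D₁ p {K : Finset (Sym2 V) | u ∈ cl K o ∧ c ∈ cl K o}
        - PrW D₁ p {K : Finset (Sym2 V) | u ∈ cl K o} * PrW D₁ p {K : Finset (Sym2 V) | c ∈ cl K o}) ^ 2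
        ≤ C * PrW D₁ p {K : Finset (Sym2 V) | u ∈ cl K o} * PrW D₁ p {K : Finset (Sym2 V) | c ∈ cl K o}
          * PrW D₁ p {K : Finset (Sym2 V) | u ∉ cl K o ∧ c ∈ cl K u})
    (hE₂ : (PrW D₂ p {K : Finset (Sym2 V) | v ∈ cl K o ∧ c ∈ cl K o}
        - PrW D₂ p {K : Finset (Sym2 V) | v ∈ cl K o} * PrW D₂ p {K : Finset (Sym2 V) | c ∈ cl K o}) ^ 2
        ≤ C * PrW D₂ p {K : Finset (Sym2 V) | v ∈ cl K o} * PrW D₂ p {K : Finset (Sym2 V) | c ∈ cl K o}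
          * PrW D₂ p {K : Finset (Sym2 V) | v ∉ cl K o ∧ c ∈ cl K v}) :
    (PrW (D₁ ∪ D₂) p {K : Finset (Sym2 V) | u ∈ cl K o ∧ v ∈ cl K o}
        - PrW (D₁ ∪ D₂) p {K : Finset (Sym2 V) | u ∈ cl K o} * PrW (D₁ ∪ D₂) p {K : Finset (Sym2 V) | v ∈ cl K o}) ^ 2
      ≤ C * PrW (D₁ ∪ D₂) p {K : Finset (Sym2 V) | u ∈ cl K o} * PrW (D₁ ∪ D₂) p {K : Finset (Sym2 V) | v ∈ cl K o}
        * PrW (D₁ ∪ D₂) p {K : Finset (Sym2 V) | u ∉ cl K o ∧ v ∈ cl K u} := by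
  rw [series_tau p D₁ D₂ hdisj o c u v hsep hu hv huo hvo, series_p p D₁ D₂ hdisj o c u hsep hu huo,
    series_pi p D₁ D₂ hdisj o c v hsep hv hvo, series_m p D₁ D₂ hdisj o c u v hsep hu hv huo huv]
  exact series_real C _ _ _ _ _ _ _ _ hC (PrW_nonneg D₁ hp0 hp1 _) (PrW_nonneg D₁ hp0 hp1 _) (PrW_cl_le_one D₁ hp0 hp1 _)
    (PrW_nonneg D₁ hp0 hp1 _) (PrW_nonneg D₂ hp0 hp1 _) (PrW_nonneg D₂ hp0 hp1 _) (PrW_cl_le_one D₂ hp0 hp1 _)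
    (PrW_nonneg D₂ hp0 hp1 _) (PrW_harris_cl D₁ hp0 hp1 o u c) (PrW_harris_cl D₂ hp0 hp1 o v c) hE₁ hE₂

end APL

end Summit.CriticalPhenomena.PercolationContinuityZ3.Theorems
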